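import Summits.AtomisticToContinuum.Crystallization.Theorems.OverbindingBudgetRTDictionary

/-!
# OverbindingBudget — the TIGHT dozen: charge-freeness pins the twelve contact lengths to a `1 %` band (lens-4 g28, part XII)

Helper file (`--supports stmt-AtomisticToContinuum-31280`).  Part XI (`OverbindingBudgetRTDictionary`) turned the certificate target of the
RDEF bridge piece B₁ into METRIC data, but its datum `GappedChargeFreeDozen` records the contact lengths only through the `RT` window
`[a(1 − 1/50) − T, a(1 + 1/50) + T]` (spread `±2.4 %`).  Critic row 426 (i): the SHAPE of a charge-free dozen is governed by the bond tolerance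
`θ = 1/100`, not by the `RT` spread — at a `1/100`-charge-free site ALL twelve bonds lie in `[nn_i, (1 + 1/100)·nn_i]` (census KR18: deviation
`≈ 3.95·θ`; at the `RT` spread the twisted dozens of rows 418/422 reach `η ∈ [0.046, 0.089]`, across the `1/16` knife edge).  This file adds
exactly that radial band to the metric datum, PROVES it from charge-freeness through the dictionary, and re-cuts the cone on the TIGHT target:

* `TightDozen a T Y q` (§1) := `GappedChargeFreeDozen a T Y q ∧ ∃ r > 0, ∀ p ∈ shellY a T Y q, r ≤ dist q p ≤ (1 + 1/100)·r`
  (`r = nn_q`; across a contact the two radii drift by at most `1 %`, automatically, since each end's band contains the common length).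
* `tightDozen_of_chargeFree` (§2, PROVED): at a `4`-deep chunk site charge-free with its bond neighbours, in a texture all of whose sites pass
  `RT a T` (`47/50 ≤ a ≤ 1`, `0 ≤ T ≤ 1/250`), `TightDozen a T Y (y i)` holds.
* **`TightDozenRigidity T₀`** (§1) — THE METRIC CERTIFICATE TARGET OF RECORD (WEAKER than part XI's `GappedDozenRigidity T₀`:
  `gappedDozenRigidity_imp_tight`): a site of a set all of whose sites pass `RT a T₀`, whose own dozen and whose twelve neighbours' dozens are
  TIGHT gapped charge-free dozens, is `(3/50, gap 1/500, 9/10, 1)`-two-shell-good.  [KR2 at `θ = 1/100` on 13 dozens ∧ GRAPH-ID ∧ cap identity;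
  UNDECIDED·TRUE-type, certificate-class.  SCALE-SEAM (row 426 (ii)): the pattern scale is pinned to `aHi = 1` by N's binder `IsClean` inside
  `IsDoorSet` (consumer of `CleanTwoShell` via `isDoorSet_of_locallyOptimal`), while `RT` admits local scale up to `1.02a + T₀ ≤ 1.024`; the
  shape budget left at the second shell is `3/50 − √2·(s_loc − 1)₊ ≥ 0.026` — census TAG 157 decides.] [piece]
* `localTwoShellRigidity_of_tight` (§3, PROVED, `0 ≤ T₀ ≤ 1/250`) and the cone `rdef_of_grossU_doorPeriodic_tight` (§3).
-/

namespace Summit.AtomisticToContinuum.Crystallization.Theorems.OverbindingBudgetTightDozen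

open scoped Classical
open Literature.Geometry.DiscreteGeometry (IsChargeFree bondGraph nearestDist mem_neighborSet_bondGraph nearestDist_le_dist le_nearestDist)
open Summit.AtomisticToContinuum.Crystallization.Theses.OverbindingBudget (RobustDefectLimitWindows)
open Summit.AtomisticToContinuum.Crystallization.Theses.PricedLinkCensus (ChargedEnergyGap)
open Summit.AtomisticToContinuum.Crystallization.Theorems.OverbindingBudgetGradedBareness (CleanlessExcessT)
open Summit.AtomisticToContinuum.Crystallization.Theorems.OverbindingBudgetCoherentCut (CoherentResidual)
open Summit.AtomisticToContinuum.Crystallization.Theorems.OverbindingBudgetUniformCutStatements (GrossCleanBallsU)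
open Summit.AtomisticToContinuum.Crystallization.Theorems.OverbindingBudgetViolatorDensityFloor (RT)
open Summit.AtomisticToContinuum.Crystallization.Theorems.OverbindingBudgetEdgeRelaxationStatements (CleanClass)
open Summit.AtomisticToContinuum.Crystallization.Theorems.OverbindingBudgetElasticSplitScale (HasCompressedScale CompressedVirialLaw)
open Summit.AtomisticToContinuum.Crystallization.Theorems.OverbindingBudgetElasticSplitPeriodic (PeriodicStrainedCubes)
open Summit.AtomisticToContinuum.Crystallization.Theorems.OverbindingBudgetElasticSplitDoorBridge (CleanCharted rdef_of_grossU_doorPeriodic)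
open Summit.AtomisticToContinuum.Crystallization.Theorems.ChartedPlanarOrderDoorLayered (DoorPeriodic)
open Summit.AtomisticToContinuum.Crystallization.Theorems.OverbindingBudgetTwoShellTransfer (IsTwoShellGoodSetGap LocalTwoShellRigidity
  cleanTwoShell_of_ballPieces chargeFreeBallRigidity_of_local)
open Summit.AtomisticToContinuum.Crystallization.Theorems.OverbindingBudgetLimitChargeFreeBall (limitChargeFreeBall_holds)
open Summit.AtomisticToContinuum.Crystallization.Theorems.OverbindingBudgetRTDictionary (shellIdx shellY GappedChargeFreeDozen
  GappedDozenRigidity exists_eq_of_dist_lt_two mem_of_range neighborSet_eq_shellIdx nearestDist_le_contact dist_le_of_mem_neighborSet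
  deep_of_dist_le gappedDozen_of_chargeFree)

/-! ## §1 The tight datum and the tight certificate target -/

/-- **The tight metric datum**: a gapped charge-free dozen whose twelve contact lengths lie in ONE band `[r, (1 + 1/100)·r]`. -/
def TightDozen (a T : ℝ) (Y : Set (EuclideanSpace ℝ (Fin 3))) (q : EuclideanSpace ℝ (Fin 3)) : Prop :=
  GappedChargeFreeDozen a T Y q ∧ ∃ r : ℝ, 0 < r ∧ ∀ p ∈ shellY a T Y q, r ≤ dist q p ∧ dist q p ≤ (1 + 1 / 100) * r

/-- **The metric certificate target of record** (slot 4 of the RDEF cone): thirteen TIGHT gapped charge-free dozens around `q` in a set all of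
whose sites pass `RT a T₀` make `q` `(3/50, gap 1/500, 9/10, 1)`-two-shell-good. [KR2 at θ = 1/100 ∧ GRAPH-ID ∧ caps; UNDECIDED·TRUE-type,
certificate-class; SCALE-SEAM risk at local scale > 1.] [piece] -/
def TightDozenRigidity (T₀ : ℝ) : Prop :=
  ∀ (a : ℝ) (Y : Set (EuclideanSpace ℝ (Fin 3))) (q : EuclideanSpace ℝ (Fin 3)), 47 / 50 ≤ a → a ≤ 1 → q ∈ Y →
    (∀ w ∈ Y, RT a T₀ Y w) → TightDozen a T₀ Y q → (∀ p ∈ shellY a T₀ Y q, TightDozen a T₀ Y p) →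
    IsTwoShellGoodSetGap (3 / 50) (1 / 500) (9 / 10) 1 Y q

/-- Part XI's target implies the tight one (more hypotheses, same conclusion). [this file] -/
theorem gappedDozenRigidity_imp_tight {T₀ : ℝ} (h : GappedDozenRigidity T₀) : TightDozenRigidity T₀ :=
  fun a Y q ha ha1 hq hRT hd hN => h a Y q ha ha1 hq hRT hd.1 fun p hp => (hN p hp).1

/-! ## §2 The radial band from charge-freeness -/

section Chunk

variable {Y : Set (EuclideanSpace ℝ (Fin 3))} {c : EuclideanSpace ℝ (Fin 3)} {ℓ a T : ℝ} {N : ℕ}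
  {y : Fin N → EuclideanSpace ℝ (Fin 3)} {i : Fin N}

/-- **Radial band, PROVED.** At a `2`-deep charge-free chunk site of a texture passing `RT a T` everywhere, every member of the contact shell
lies at distance in `[nn_i, (1 + 1/100)·nn_i]`, and `nn_i > 0`. [this file] -/
theorem radialBand_of_chargeFree (hRT : ∀ w ∈ Y, RT a T Y w) (ha : 47 / 50 ≤ a) (ha1 : a ≤ 1) (hT0 : 0 ≤ T) (hT : T ≤ 1 / 250)
    (hy : Function.Injective y) (hr : Set.range y = Y ∩ {z | ∀ j : Fin 3, c j ≤ z j ∧ z j < c j + ℓ})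
    (hdeep : ∀ j : Fin 3, c j + 2 ≤ y i j ∧ y i j + 2 ≤ c j + ℓ) (hcf : IsChargeFree (1 / 100 : ℝ) y i) :
    0 < nearestDist y i ∧ ∀ p ∈ shellY a T Y (y i), nearestDist y i ≤ dist (y i) p ∧ dist (y i) p ≤ (1 + 1 / 100) * nearestDist y i := by
  have hstar := neighborSet_eq_shellIdx hRT ha ha1 hT0 hT hy hr hdeep hcf
  have hRTi := hRT (y i) (mem_of_range hr i)
  -- the shell is non-empty, so there is another chunk index and `nn_i` obeys the `RT` lower bound
  have hne : (shellY a T Y (y i)).Nonempty := by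
    refine Set.nonempty_of_ncard_ne_zero ?_
    have h12 := hRTi.2.1
    change 12 ≤ (shellY a T Y (y i)).ncard at h12
    omega
  obtain ⟨w, hw, hwne, hwd⟩ := hne
  obtain ⟨k, rfl⟩ := exists_eq_of_dist_lt_two hr hdeep hw (by linarith)
  have hki : k ≠ i := fun h => hwne (by rw [h])
  have hpos : 0 < nearestDist y i := by
    have hlow : a * (1 - 1 / 50) - T ≤ nearestDist y i :=
      le_nearestDist ⟨k, hki⟩ fun k' hk' => ((hRTi.2.2 (y k') (mem_of_range hr k') (hy.ne hk')).1)
    linarith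
  refine ⟨hpos, ?_⟩
  rintro p ⟨hp, hpne, hpd⟩
  obtain ⟨j, rfl⟩ := exists_eq_of_dist_lt_two hr hdeep hp (by linarith)
  have hjS : j ∈ shellIdx a T y i := ⟨fun h => hpne (congrArg y h), hpd⟩
  have hjN : j ∈ (bondGraph (1 / 100 : ℝ) y).neighborSet i := by rw [hstar]; exact hjS
  rw [mem_neighborSet_bondGraph] at hjN
  exact ⟨nearestDist_le_dist y (fun h => hpne (congrArg y h)),
    hjN.2.trans (mul_le_mul_of_nonneg_left (min_le_left _ _) (by norm_num))⟩

/-- **Tight dozen from charge-freeness, PROVED.** [this file] -/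
theorem tightDozen_of_chargeFree (hRT : ∀ w ∈ Y, RT a T Y w) (ha : 47 / 50 ≤ a) (ha1 : a ≤ 1) (hT0 : 0 ≤ T) (hT : T ≤ 1 / 250)
    (hy : Function.Injective y) (hr : Set.range y = Y ∩ {z | ∀ j : Fin 3, c j ≤ z j ∧ z j < c j + ℓ})
    (hdeep : ∀ j : Fin 3, c j + 4 ≤ y i j ∧ y i j + 4 ≤ c j + ℓ) (hcf : IsChargeFree (1 / 100 : ℝ) y i)
    (hcfN : ∀ j ∈ (bondGraph (1 / 100 : ℝ) y).neighborSet i, IsChargeFree (1 / 100 : ℝ) y j) : TightDozen a T Y (y i) := by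
  have hdeep2 : ∀ j : Fin 3, c j + 2 ≤ y i j ∧ y i j + 2 ≤ c j + ℓ := by
    intro j; obtain ⟨h1, h2⟩ := hdeep j; constructor <;> linarith
  obtain ⟨hpos, hband⟩ := radialBand_of_chargeFree hRT ha ha1 hT0 hT hy hr hdeep2 hcf
  exact ⟨gappedDozen_of_chargeFree hRT ha ha1 hT0 hT hy hr hdeep hcf hcfN, nearestDist y i, hpos, hband⟩

end Chunk

/-! ## §3 The seam and the cone -/

set_option maxHeartbeats 800000 in
/-- **Seam, PROVED.** `TightDozenRigidity T₀ → LocalTwoShellRigidity T₀ D` for `0 ≤ T₀ ≤ 1/250`. [this file] -/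
theorem localTwoShellRigidity_of_tight {T₀ D : ℝ} (hT0 : 0 ≤ T₀) (hT : T₀ ≤ 1 / 250) (h : TightDozenRigidity T₀) :
    LocalTwoShellRigidity T₀ D := by
  intro Y hY _hnc c ℓ N y i hy hr hdeep hcf3
  obtain ⟨a, ha, ha1, hRT⟩ := hY.2.2.2.2.2
  have hdeep4 : ∀ j : Fin 3, c j + 4 ≤ y i j ∧ y i j + 4 ≤ c j + ℓ := by
    intro j; obtain ⟨h1, h2⟩ := hdeep j; constructor <;> linarith
  have hdeep2 : ∀ j : Fin 3, c j + 2 ≤ y i j ∧ y i j + 2 ≤ c j + ℓ := by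
    intro j; obtain ⟨h1, h2⟩ := hdeep j; constructor <;> linarith
  have hcfi : IsChargeFree (1 / 100 : ℝ) y i := hcf3 i (by rw [dist_self]; norm_num)
  have hcfnbr : ∀ k : Fin N, dist (y i) (y k) ≤ 1.96 → (∀ j : Fin 3, c j + 2 ≤ y k j ∧ y k j + 2 ≤ c j + ℓ) →
      ∀ m ∈ (bondGraph (1 / 100 : ℝ) y).neighborSet k, IsChargeFree (1 / 100 : ℝ) y m := by
    intro k hk hdeepk m hm
    have hdm := dist_le_of_mem_neighborSet hRT ha1 hT hr hdeepk hm
    refine hcf3 m ?_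
    have htri := dist_triangle (y m) (y k) (y i)
    rw [dist_comm (y m) (y k), dist_comm (y k) (y i)] at htri
    nlinarith [htri, hdm, hk, ha1, hT]
  have hdoz := tightDozen_of_chargeFree hRT ha ha1 hT0 hT hy hr hdeep4 hcfi (hcfnbr i (by rw [dist_self]; norm_num) hdeep2)
  refine h a Y (y i) ha ha1 (mem_of_range hr i) hRT hdoz ?_
  rintro p ⟨hp, hpne, hpd⟩
  obtain ⟨j, rfl⟩ := exists_eq_of_dist_lt_two hr hdeep2 hp (by linarith)
  have hdj : dist (y i) (y j) ≤ 1.96 := by linarith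
  have hdeep6 : ∀ k : Fin 3, c k + (4 + 1.96) ≤ y i k ∧ y i k + (4 + 1.96) ≤ c k + ℓ := by
    intro k; obtain ⟨h1, h2⟩ := hdeep k; constructor <;> linarith
  have hdeepj4 : ∀ k : Fin 3, c k + 4 ≤ y j k ∧ y j k + 4 ≤ c k + ℓ := deep_of_dist_le hdeep6 hdj
  have hdeepj2 : ∀ k : Fin 3, c k + 2 ≤ y j k ∧ y j k + 2 ≤ c k + ℓ := by
    intro k; obtain ⟨h1, h2⟩ := hdeepj4 k; constructor <;> linarith
  have hcfj : IsChargeFree (1 / 100 : ℝ) y j := hcf3 j (by rw [dist_comm]; linarith)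
  exact tightDozen_of_chargeFree hRT ha ha1 hT0 hT hy hr hdeepj4 hcfj (hcfnbr j hdj hdeepj2)

/-- **RDEF cone with the TIGHT metric rigidity piece** (every `Λ`): `GrossCleanBallsU (1/250) 10 → ChargedEnergyGap →
CompressedVirialLaw (1/250) 10 → TightDozenRigidity (1/250) → CleanCharted (1/250) 10 → DoorPeriodic Λ →
PeriodicStrainedCubes Λ (1/250) 10 → CleanlessExcessT → CoherentResidual 10 → RobustDefectLimitWindows`. [this file] -/
theorem rdef_of_grossU_doorPeriodic_tight (Λ : ℝ) (hG : GrossCleanBallsU (1 / 250) 10) (hCEG : ChargedEnergyGap)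
    (hC : CompressedVirialLaw (1 / 250) 10) (hK : TightDozenRigidity (1 / 250)) (h₂ : CleanCharted (1 / 250) 10) (hD : DoorPeriodic Λ)
    (hE : PeriodicStrainedCubes Λ (1 / 250) 10) (hCE : CleanlessExcessT) (hR : CoherentResidual 10) : RobustDefectLimitWindows :=
  rdef_of_grossU_doorPeriodic Λ hG hCEG hC
    (cleanTwoShell_of_ballPieces (limitChargeFreeBall_holds (1 / 250) 10)
      (chargeFreeBallRigidity_of_local (by norm_num) (localTwoShellRigidity_of_tight (by norm_num) (by norm_num) hK))) h₂ hD hE hCE hR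

end Summit.AtomisticToContinuum.Crystallization.Theorems.OverbindingBudgetTightDozen
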